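import Literature.NumberTheory.EllipticCurves.PAdicOneVariableNormCoherentUnitInduceMomentsTwo
import HarnessLib

/-!
# `p = 2`, ABSTRACT TOWER: de Shalit's `i = induce D` for a `G`-monoid `B` mapped to the norm-coherent units of
# the local Lubin–Tate tower, along ANY subgroup tower `𝒰` of ANY group `G` cut out by a character
# `κ : G → ℤ₂ˣ` — additivity, `U_0`-equivariance (`hD`), and the homomorphism properties of `i`

Topic `NumberTheory/EllipticCurves`; namespace `Literature.NumberTheory.EllipticCurves`.

De Shalit, *Iwasawa theory of elliptic curves with complex multiplication* (1987), II.4.6 (p. 59): the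
semi-local units `𝒰 = ∏_𝔓 𝒰_𝔓` of `K(𝔣𝔭^∞)` are a `𝒢`-set, `𝒢 = Gal(K(𝔣𝔭^∞)/K)`; for `β ∈ 𝒰` the measure
`μ_β` on `G = Gal(K(𝔣𝔭^∞)/K(𝔣))` is the LOCAL measure of the `𝔓`-component (I.3.3–3.4, `G ≅` the local
Galois group of the division tower, `κ` the character on `E[𝔭^∞]`), and `i(β)` is its extension to `𝒢` coset
by coset (14).  The sibling files (`…NormCoherentUnitFamilyTwo`, `…ComapEquivariantTwo`,
`…InduceMomentsTwo`) did this for `G := Γ_F` along the local Lubin–Tate tower `ltTower`.  For the GLOBAL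
assembly the group is the global Galois group with its ray-class tower, which acts on the `𝔓`-components
THROUGH the local Galois group: THIS file redoes the package for an ABSTRACT group `G`, tower `𝒰` and character
`κ : G →* ℤ₂ˣ` with the cell hypotheses `hU`/`hκ`/`hψ` of `ProfiniteGroupDistributionCharacterCells.lean`, the
`G`-action on `B` being tied to the local tower only by

  `hη : ∀ g ∈ U_0, ∀ b, ∃ σ ∈ Γ_F, η (g • b) = (η b).galAct σ ∧ e(χ_{π'}(σ)) = κ g`

("`g` acts on the `𝔓`-component through an element `σ` of the decomposition group with the same value of the
character"):

* §1 `comap_μ_normCoherentUnits_mul_of_character` / `_one_of_character` — **`D_{bb'} = D_b + D_{b'}`, `D_1 = 0`**;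
* §2 ★★ `comap_μ_proj_mul_normCoherentUnits_of_character` — **the `U_0`-equivariance `hD`** of the family
  `b ↦ D_b = comap ((x⁻¹ D_{H_{η b}})|_{ℤ₂ˣ}) ψ` (from the local Lemma I.3.4 (ii),
  `restrictUnits_density_unitInv_μ_unitMul_normCoherentUnits_galAct`, through `comap_family_equivariant_of_character`);
* §3 ★★ `induce_μ_mul/_one/_pow/_smul_of_character` — `i := GroupDistribution.induce D` is additive,
  `i(1) = 0`, `i(b^N) = N·i(b)`, and **`i(g • b)(ḡ a) = i(b)(a)` for EVERY `g ∈ G`** (II.4.6: "`i` is a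
  `𝒢`-homomorphism"); `induce_μ_of_transLE_eq_one_of_character` (`i(b)` reads `D_b` on `U_0`).

Everything is proved; no named facts, no definitions, no instances (section-local instance attributes as in the
siblings), no `sorry`.

## References

* [deShalit1987] E. de Shalit, *Iwasawa theory of elliptic curves with complex multiplication* (1987),
  I.3.4 Lemma (i), (ii) and Corollary (p. 18), II.4.6 (12)–(14) (p. 59), I.3.3 (9) (p. 18).
-/

noncomputable section

open MvPowerSeries Filter
open scoped Topology Classical

namespace Literature.NumberTheory.EllipticCurves

section NormCoherentUnitFamilyAbstract

open ValuativeRel IsLocalRing Field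
open Literature.NumberTheory.GaloisRepresentations Literature.NumberTheory.GaloisRepresentations.IsNonarchimedeanLocalField
  Literature.NumberTheory.GaloisRepresentations.LubinTate Literature.NumberTheory.PAdicHodge

variable {F : Type} [Field F] [ValuativeRel F] [TopologicalSpace F] [IsNonarchimedeanLocalField F]

attribute [local instance] ltNormUniformSpace ltNormIsUniformAddGroup rk1 nF nE fintypeResidueField

variable (hq : residueFieldCard F = 2) (h2 : (valuation F).IsUniformizer (((2 : ℕ) : 𝒪[F]) : F))
  {σ₀ : absoluteGaloisGroup F} (hσ₀ : IsAbsArithFrob σ₀) (u : 𝒪[F]ˣ)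
  {ε : (maxUnramifiedCompletion F)ˣ}
  (hε : maxUnramifiedCompletion.galAut F σ₀ (ε : maxUnramifiedCompletion F) =
    algebraMap 𝒪[F] (maxUnramifiedCompletion F) (u : 𝒪[F]) * (ε : maxUnramifiedCompletion F))
variable {𝕜 : Type*} [NormedField 𝕜] [NormedAlgebra ℚ_[2] 𝕜] [IsUltrametricDist 𝕜] [CompleteSpace 𝕜]
  (Θ : UnrCoeff F →+* 𝕜) (e : 𝒪[F] →+* ℤ_[2])
  (hΘe : ∀ a : 𝒪[F], Θ (intToUnrCoeff F a) = padicIntCast 𝕜 (e a))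
variable {G : Type*} [Group G] {𝒰 : SubgroupTower G} [∀ n, (𝒰.U n).Normal] (κ : G →* ℤ_[2]ˣ)
  (hU : ∀ (n : ℕ) (g : G), g ∈ 𝒰.U n ↔ g ∈ 𝒰.U 0 ∧ PadicInt.toZModPow (n + 1) (κ g : ℤ_[2]) = 1)
  (hκ : ∀ (n : ℕ) (w : ℤ_[2]ˣ), PadicInt.toZModPow 1 (w : ℤ_[2]) = 1 →
    ∃ g ∈ 𝒰.U 0, PadicInt.toZModPow (n + 1) (κ g : ℤ_[2]) = PadicInt.toZModPow (n + 1) (w : ℤ_[2]))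
  (ψ : (n : ℕ) → G ⧸ 𝒰.U n → ZMod (2 ^ (n + 1)))
  (hψ : ∀ (n : ℕ) (g : G), g ∈ 𝒰.U 0 → ψ n (𝒰.proj n g) = PadicInt.toZModPow (n + 1) (κ g : ℤ_[2]))

/-! ### §1. Additivity of `b ↦ D_b` along the abstract tower -/

/-- **`D_{ββ'} = D_β + D_{β'}` levelwise** along any tower cut out by a character (de Shalit I.3.4 Lemma (i);
the additivity lemmas of `PAdicDistributionAdditivity.lean`). [cite: deShalit1987, I.3.4 Lemma (i) (p. 18), II.4.6 (p. 59)] -/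
theorem comap_μ_normCoherentUnits_mul_of_character (β β' : NormCoherentUnits (isUniformizer_unit_mul h2 u))
    {C C₁ C₂ : ℝ} (hC : ∀ k : ℕ, ‖PowerSeries.coeff k ((PowerSeries.subst (compSeriesC h2 hσ₀ u hε)
          ((tildeSer ((u : 𝒪[F]) * ((2 : ℕ) : 𝒪[F])) (LTCoeff.of F (u : 𝒪[F])) (β.mul β').logDeriv).map
            ((intToUnrCoeff F).comp (LTCoeff.of F).symm.toRingHom))).map Θ)‖ ≤ C)
    (hC₁ : ∀ k : ℕ, ‖PowerSeries.coeff k ((PowerSeries.subst (compSeriesC h2 hσ₀ u hε)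
          ((tildeSer ((u : 𝒪[F]) * ((2 : ℕ) : 𝒪[F])) (LTCoeff.of F (u : 𝒪[F])) β.logDeriv).map
            ((intToUnrCoeff F).comp (LTCoeff.of F).symm.toRingHom))).map Θ)‖ ≤ C₁)
    (hC₂ : ∀ k : ℕ, ‖PowerSeries.coeff k ((PowerSeries.subst (compSeriesC h2 hσ₀ u hε)
          ((tildeSer ((u : 𝒪[F]) * ((2 : ℕ) : 𝒪[F])) (LTCoeff.of F (u : 𝒪[F])) β'.logDeriv).map
            ((intToUnrCoeff F).comp (LTCoeff.of F).symm.toRingHom))).map Θ)‖ ≤ C₂)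
    (n : ℕ) (a : G ⧸ 𝒰.U n) :
    (GroupDistribution.comap (restrictUnits ((invAmice₁ 2 ((PowerSeries.subst (compSeriesC h2 hσ₀ u hε)
          ((tildeSer ((u : 𝒪[F]) * ((2 : ℕ) : 𝒪[F])) (LTCoeff.of F (u : 𝒪[F])) (β.mul β').logDeriv).map
            ((intToUnrCoeff F).comp (LTCoeff.of F).symm.toRingHom))).map Θ) hC).density
          (ProfiniteTower.padicInt_isUniform 2) (unitInv 𝕜) uniformContinuous_unitInv norm_unitInv_le))
          ψ (𝒰.cellMap_trans κ ψ hψ) (𝒰.cellMap_injective κ hU ψ hψ) (𝒰.cellMap_fiberSurj κ hU hκ ψ hψ)).μ n a =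
      (GroupDistribution.comap (restrictUnits ((invAmice₁ 2 ((PowerSeries.subst (compSeriesC h2 hσ₀ u hε)
          ((tildeSer ((u : 𝒪[F]) * ((2 : ℕ) : 𝒪[F])) (LTCoeff.of F (u : 𝒪[F])) β.logDeriv).map
            ((intToUnrCoeff F).comp (LTCoeff.of F).symm.toRingHom))).map Θ) hC₁).density
          (ProfiniteTower.padicInt_isUniform 2) (unitInv 𝕜) uniformContinuous_unitInv norm_unitInv_le))
          ψ (𝒰.cellMap_trans κ ψ hψ) (𝒰.cellMap_injective κ hU ψ hψ) (𝒰.cellMap_fiberSurj κ hU hκ ψ hψ)).μ n a +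
        (GroupDistribution.comap (restrictUnits ((invAmice₁ 2 ((PowerSeries.subst (compSeriesC h2 hσ₀ u hε)
          ((tildeSer ((u : 𝒪[F]) * ((2 : ℕ) : 𝒪[F])) (LTCoeff.of F (u : 𝒪[F])) β'.logDeriv).map
            ((intToUnrCoeff F).comp (LTCoeff.of F).symm.toRingHom))).map Θ) hC₂).density
          (ProfiniteTower.padicInt_isUniform 2) (unitInv 𝕜) uniformContinuous_unitInv norm_unitInv_le))
          ψ (𝒰.cellMap_trans κ ψ hψ) (𝒰.cellMap_injective κ hU ψ hψ) (𝒰.cellMap_fiberSurj κ hU hκ ψ hψ)).μ n a := by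
  have h₁ := invAmice₁_μ_eq_add_of_eq_add (p := 2) (map_subst_tildeSer_logDeriv_mul h2 hσ₀ u hε Θ β β') hC hC₁ hC₂
  have h₂ := BoundedDistribution.density_μ_eq_add_of_μ_eq_add _ _ _ h₁ (ProfiniteTower.padicInt_isUniform 2)
    (unitInv 𝕜) uniformContinuous_unitInv norm_unitInv_le
  have h₃ := restrictUnits_μ_eq_add_of_μ_eq_add _ _ _ h₂
  exact GroupDistribution.comap_μ_eq_add_of_μ_eq_add (T := (ProfiniteTower.padicInt 2).succ) _ _ _ ψ _ _ _ h₃ n a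

/-- **`D_1 = 0` levelwise** along any tower cut out by a character. [cite: deShalit1987, I.3.4 Lemma (i) (p. 18)] -/
theorem comap_μ_normCoherentUnits_one_of_character {C : ℝ}
    (hC : ∀ k : ℕ, ‖PowerSeries.coeff k ((PowerSeries.subst (compSeriesC h2 hσ₀ u hε)
          ((tildeSer ((u : 𝒪[F]) * ((2 : ℕ) : 𝒪[F])) (LTCoeff.of F (u : 𝒪[F])) (NormCoherentUnits.one : NormCoherentUnits (isUniformizer_unit_mul h2 u)).logDeriv).map
            ((intToUnrCoeff F).comp (LTCoeff.of F).symm.toRingHom))).map Θ)‖ ≤ C)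
    (n : ℕ) (a : G ⧸ 𝒰.U n) :
    (GroupDistribution.comap (restrictUnits ((invAmice₁ 2 ((PowerSeries.subst (compSeriesC h2 hσ₀ u hε)
          ((tildeSer ((u : 𝒪[F]) * ((2 : ℕ) : 𝒪[F])) (LTCoeff.of F (u : 𝒪[F])) (NormCoherentUnits.one : NormCoherentUnits (isUniformizer_unit_mul h2 u)).logDeriv).map
            ((intToUnrCoeff F).comp (LTCoeff.of F).symm.toRingHom))).map Θ) hC).density
          (ProfiniteTower.padicInt_isUniform 2) (unitInv 𝕜) uniformContinuous_unitInv norm_unitInv_le))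
          ψ (𝒰.cellMap_trans κ ψ hψ) (𝒰.cellMap_injective κ hU ψ hψ) (𝒰.cellMap_fiberSurj κ hU hκ ψ hψ)).μ n a = 0 := by
  have h₁ := invAmice₁_μ_eq_zero_of_eq_zero (p := 2) (map_subst_tildeSer_logDeriv_one h2 hσ₀ u hε Θ) hC
  have h₂ := BoundedDistribution.density_μ_eq_zero_of_μ_eq_zero _ h₁ (ProfiniteTower.padicInt_isUniform 2)
    (unitInv 𝕜) uniformContinuous_unitInv norm_unitInv_le
  have h₃ := restrictUnits_μ_eq_zero_of_μ_eq_zero _ h₂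
  exact GroupDistribution.comap_μ_eq_zero_of_μ_eq_zero (T := (ProfiniteTower.padicInt 2).succ) _ ψ _ _ _ h₃ n a

/-! ### §2. The `U_0`-equivariance `hD`, the action passing through the local Galois group -/

variable {B : Type*} [Monoid B] [MulDistribMulAction G B]
  (η : B → NormCoherentUnits (isUniformizer_unit_mul h2 u))
  (hη : ∀ g ∈ 𝒰.U 0, ∀ b : B, ∃ σ : absoluteGaloisGroup F, η (g • b) = (η b).galAct σ ∧
    Units.map (e : 𝒪[F] →* ℤ_[2]) (lubinTateChar (isUniformizer_unit_mul h2 u) σ) = κ g)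
  {C : ℝ}
  (hC : ∀ (b : B) (k : ℕ), ‖PowerSeries.coeff k ((PowerSeries.subst (compSeriesC h2 hσ₀ u hε)
          ((tildeSer ((u : 𝒪[F]) * ((2 : ℕ) : 𝒪[F])) (LTCoeff.of F (u : 𝒪[F])) (η b).logDeriv).map
            ((intToUnrCoeff F).comp (LTCoeff.of F).symm.toRingHom))).map Θ)‖ ≤ C)

include hq hΘe hη in
/-- ★★ **`U_0`-equivariance of `b ↦ D_b` along the abstract tower**: for `g ∈ U_0`, `b ∈ B` and every cell
`a ⊆ U_0`, **`D_{g•b}(ḡ a) = D_b(a)`** — the hypothesis `hD` of `GroupDistribution.induce` — whenever `g` acts on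
`η b` through some `σ ∈ Γ_F` with `e(χ_{π'}(σ)) = κ(g)` (the local Lemma I.3.4 (ii) transported by
`comap_family_equivariant_of_character`). [cite: deShalit1987, I.3.4 Lemma (ii) (p. 18), II.4.6 (14) (p. 59)] -/
theorem comap_μ_proj_mul_normCoherentUnits_of_character :
    ∀ g ∈ 𝒰.U 0, ∀ (b : B) (n : ℕ) (a : G ⧸ 𝒰.U n), 𝒰.transLE (Nat.zero_le n) a = 1 →
      (GroupDistribution.comap (restrictUnits ((invAmice₁ 2 ((PowerSeries.subst (compSeriesC h2 hσ₀ u hε)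
          ((tildeSer ((u : 𝒪[F]) * ((2 : ℕ) : 𝒪[F])) (LTCoeff.of F (u : 𝒪[F])) (η (g • b)).logDeriv).map
            ((intToUnrCoeff F).comp (LTCoeff.of F).symm.toRingHom))).map Θ) (hC (g • b))).density
          (ProfiniteTower.padicInt_isUniform 2) (unitInv 𝕜) uniformContinuous_unitInv norm_unitInv_le))
          ψ (𝒰.cellMap_trans κ ψ hψ) (𝒰.cellMap_injective κ hU ψ hψ) (𝒰.cellMap_fiberSurj κ hU hκ ψ hψ)).μ n (𝒰.proj n g * a) =
        (GroupDistribution.comap (restrictUnits ((invAmice₁ 2 ((PowerSeries.subst (compSeriesC h2 hσ₀ u hε)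
          ((tildeSer ((u : 𝒪[F]) * ((2 : ℕ) : 𝒪[F])) (LTCoeff.of F (u : 𝒪[F])) (η b).logDeriv).map
            ((intToUnrCoeff F).comp (LTCoeff.of F).symm.toRingHom))).map Θ) (hC b)).density
          (ProfiniteTower.padicInt_isUniform 2) (unitInv 𝕜) uniformContinuous_unitInv norm_unitInv_le))
          ψ (𝒰.cellMap_trans κ ψ hψ) (𝒰.cellMap_injective κ hU ψ hψ) (𝒰.cellMap_fiberSurj κ hU hκ ψ hψ)).μ n a := by
  refine GroupDistribution.comap_family_equivariant_of_character κ
    (fun b ↦ (restrictUnits ((invAmice₁ 2 ((PowerSeries.subst (compSeriesC h2 hσ₀ u hε)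
          ((tildeSer ((u : 𝒪[F]) * ((2 : ℕ) : 𝒪[F])) (LTCoeff.of F (u : 𝒪[F])) (η b).logDeriv).map
            ((intToUnrCoeff F).comp (LTCoeff.of F).symm.toRingHom))).map Θ) (hC b)).density
          (ProfiniteTower.padicInt_isUniform 2) (unitInv 𝕜) uniformContinuous_unitInv norm_unitInv_le))) hU hκ ψ hψ ?_
  intro g hg b n c
  obtain ⟨σ, hσ, hκσ⟩ := hη g hg b
  have hC' : ∀ k : ℕ, ‖PowerSeries.coeff k ((PowerSeries.subst (compSeriesC h2 hσ₀ u hε)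
          ((tildeSer ((u : 𝒪[F]) * ((2 : ℕ) : 𝒪[F])) (LTCoeff.of F (u : 𝒪[F])) ((η b).galAct σ).logDeriv).map
            ((intToUnrCoeff F).comp (LTCoeff.of F).symm.toRingHom))).map Θ)‖ ≤ C := by
    rw [← hσ]; exact hC (g • b)
  have key := restrictUnits_density_unitInv_μ_unitMul_normCoherentUnits_galAct hq h2 hσ₀ u hε Θ e hΘe σ (η b)
    (hC b) hC' n c
  rw [hκσ] at key
  rw [← key]
  exact restrictUnits_μ_congr_of_μ_eq _ _ (BoundedDistribution.density_μ_congr_of_μ_eq _ _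
    (invAmice₁_μ_congr (p := 2) (by rw [hσ]) _ _) _ _ _ _) n _

/-! ### §3. `i := induce D` along the abstract tower: de Shalit's I.3.4 Corollary / II.4.6 -/

variable (hηmul : ∀ b b' : B, η (b * b') = (η b).mul (η b'))
  (hC0 : 0 ≤ C)
  (hCb : ∀ b : B, (GroupDistribution.comap (restrictUnits ((invAmice₁ 2 ((PowerSeries.subst (compSeriesC h2 hσ₀ u hε)
          ((tildeSer ((u : 𝒪[F]) * ((2 : ℕ) : 𝒪[F])) (LTCoeff.of F (u : 𝒪[F])) (η b).logDeriv).map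
            ((intToUnrCoeff F).comp (LTCoeff.of F).symm.toRingHom))).map Θ) (hC b)).density
          (ProfiniteTower.padicInt_isUniform 2) (unitInv 𝕜) uniformContinuous_unitInv norm_unitInv_le))
          ψ (𝒰.cellMap_trans κ ψ hψ) (𝒰.cellMap_injective κ hU ψ hψ) (𝒰.cellMap_fiberSurj κ hU hκ ψ hψ)).bound ≤ C)

include hηmul in
/-- ★★ **Additivity of `i` along the abstract tower: `i(bb')_n(a) = i(b)_n(a) + i(b')_n(a)`** (the `hadd` of
`exists_twisting_μ_eq_forall_of_units`). [cite: deShalit1987, I.3.4 Lemma (i) and Corollary (p. 18), II.4.6 (p. 59)] -/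
theorem induce_μ_mul_of_character (b b' : B) (n : ℕ) (a : G ⧸ 𝒰.U n) :
    (GroupDistribution.induce (fun b ↦ (GroupDistribution.comap (restrictUnits ((invAmice₁ 2 ((PowerSeries.subst (compSeriesC h2 hσ₀ u hε)
          ((tildeSer ((u : 𝒪[F]) * ((2 : ℕ) : 𝒪[F])) (LTCoeff.of F (u : 𝒪[F])) (η b).logDeriv).map
            ((intToUnrCoeff F).comp (LTCoeff.of F).symm.toRingHom))).map Θ) (hC b)).density
          (ProfiniteTower.padicInt_isUniform 2) (unitInv 𝕜) uniformContinuous_unitInv norm_unitInv_le))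
          ψ (𝒰.cellMap_trans κ ψ hψ) (𝒰.cellMap_injective κ hU ψ hψ) (𝒰.cellMap_fiberSurj κ hU hκ ψ hψ))) hC0 hCb (b * b')).μ n a =
      (GroupDistribution.induce (fun b ↦ (GroupDistribution.comap (restrictUnits ((invAmice₁ 2 ((PowerSeries.subst (compSeriesC h2 hσ₀ u hε)
          ((tildeSer ((u : 𝒪[F]) * ((2 : ℕ) : 𝒪[F])) (LTCoeff.of F (u : 𝒪[F])) (η b).logDeriv).map
            ((intToUnrCoeff F).comp (LTCoeff.of F).symm.toRingHom))).map Θ) (hC b)).density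
          (ProfiniteTower.padicInt_isUniform 2) (unitInv 𝕜) uniformContinuous_unitInv norm_unitInv_le))
          ψ (𝒰.cellMap_trans κ ψ hψ) (𝒰.cellMap_injective κ hU ψ hψ) (𝒰.cellMap_fiberSurj κ hU hκ ψ hψ))) hC0 hCb b).μ n a +
        (GroupDistribution.induce (fun b ↦ (GroupDistribution.comap (restrictUnits ((invAmice₁ 2 ((PowerSeries.subst (compSeriesC h2 hσ₀ u hε)
          ((tildeSer ((u : 𝒪[F]) * ((2 : ℕ) : 𝒪[F])) (LTCoeff.of F (u : 𝒪[F])) (η b).logDeriv).map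
            ((intToUnrCoeff F).comp (LTCoeff.of F).symm.toRingHom))).map Θ) (hC b)).density
          (ProfiniteTower.padicInt_isUniform 2) (unitInv 𝕜) uniformContinuous_unitInv norm_unitInv_le))
          ψ (𝒰.cellMap_trans κ ψ hψ) (𝒰.cellMap_injective κ hU ψ hψ) (𝒰.cellMap_fiberSurj κ hU hκ ψ hψ))) hC0 hCb b').μ n a := by
  refine GroupDistribution.induce_μ_mul _ hC0 hCb (fun b b' n a ↦ ?_) b b' n a
  have hC' : ∀ k : ℕ, ‖PowerSeries.coeff k ((PowerSeries.subst (compSeriesC h2 hσ₀ u hε)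
          ((tildeSer ((u : 𝒪[F]) * ((2 : ℕ) : 𝒪[F])) (LTCoeff.of F (u : 𝒪[F])) ((η b).mul (η b')).logDeriv).map
            ((intToUnrCoeff F).comp (LTCoeff.of F).symm.toRingHom))).map Θ)‖ ≤ C := by
    rw [← hηmul]; exact hC (b * b')
  have key := comap_μ_normCoherentUnits_mul_of_character h2 hσ₀ u hε Θ κ hU hκ ψ hψ (η b) (η b') hC' (hC b) (hC b') n a
  simp only [hηmul]
  convert key using 2

include hηmul in
/-- **`i(1) = 0`** levelwise (from additivity). [cite: deShalit1987, I.3.4 Lemma (i) (p. 18)] -/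
theorem induce_μ_one_of_character (n : ℕ) (a : G ⧸ 𝒰.U n) :
    (GroupDistribution.induce (fun b ↦ (GroupDistribution.comap (restrictUnits ((invAmice₁ 2 ((PowerSeries.subst (compSeriesC h2 hσ₀ u hε)
          ((tildeSer ((u : 𝒪[F]) * ((2 : ℕ) : 𝒪[F])) (LTCoeff.of F (u : 𝒪[F])) (η b).logDeriv).map
            ((intToUnrCoeff F).comp (LTCoeff.of F).symm.toRingHom))).map Θ) (hC b)).density
          (ProfiniteTower.padicInt_isUniform 2) (unitInv 𝕜) uniformContinuous_unitInv norm_unitInv_le))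
          ψ (𝒰.cellMap_trans κ ψ hψ) (𝒰.cellMap_injective κ hU ψ hψ) (𝒰.cellMap_fiberSurj κ hU hκ ψ hψ))) hC0 hCb 1).μ n a = 0 := by
  have h := induce_μ_mul_of_character h2 hσ₀ u hε Θ κ hU hκ ψ hψ η hC hηmul hC0 hCb 1 1 n a
  rw [mul_one] at h
  exact left_eq_add.mp h

include hηmul in
/-- **Homogeneity `i(b^N) = N · i(b)`** levelwise. [cite: deShalit1987, I.3.4 Lemma (i) (p. 18), II.4.12 (p. 69)] -/
theorem induce_μ_pow_of_character (b : B) (N n : ℕ) (a : G ⧸ 𝒰.U n) :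
    (GroupDistribution.induce (fun b ↦ (GroupDistribution.comap (restrictUnits ((invAmice₁ 2 ((PowerSeries.subst (compSeriesC h2 hσ₀ u hε)
          ((tildeSer ((u : 𝒪[F]) * ((2 : ℕ) : 𝒪[F])) (LTCoeff.of F (u : 𝒪[F])) (η b).logDeriv).map
            ((intToUnrCoeff F).comp (LTCoeff.of F).symm.toRingHom))).map Θ) (hC b)).density
          (ProfiniteTower.padicInt_isUniform 2) (unitInv 𝕜) uniformContinuous_unitInv norm_unitInv_le))
          ψ (𝒰.cellMap_trans κ ψ hψ) (𝒰.cellMap_injective κ hU ψ hψ) (𝒰.cellMap_fiberSurj κ hU hκ ψ hψ))) hC0 hCb (b ^ N)).μ n a =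
      (N : 𝕜) * (GroupDistribution.induce (fun b ↦ (GroupDistribution.comap (restrictUnits ((invAmice₁ 2 ((PowerSeries.subst (compSeriesC h2 hσ₀ u hε)
          ((tildeSer ((u : 𝒪[F]) * ((2 : ℕ) : 𝒪[F])) (LTCoeff.of F (u : 𝒪[F])) (η b).logDeriv).map
            ((intToUnrCoeff F).comp (LTCoeff.of F).symm.toRingHom))).map Θ) (hC b)).density
          (ProfiniteTower.padicInt_isUniform 2) (unitInv 𝕜) uniformContinuous_unitInv norm_unitInv_le))
          ψ (𝒰.cellMap_trans κ ψ hψ) (𝒰.cellMap_injective κ hU ψ hψ) (𝒰.cellMap_fiberSurj κ hU hκ ψ hψ))) hC0 hCb b).μ n a := by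
  induction N with
  | zero => rw [pow_zero b, induce_μ_one_of_character h2 hσ₀ u hε Θ κ hU hκ ψ hψ η hC hηmul hC0 hCb, Nat.cast_zero,
      zero_mul]
  | succ N ih => rw [pow_succ b N, induce_μ_mul_of_character h2 hσ₀ u hε Θ κ hU hκ ψ hψ η hC hηmul hC0 hCb, ih,
      Nat.cast_add_one N]; ring

include hq hΘe hη in
/-- ★★ **`i` is a `G`-homomorphism along the abstract tower: `i(g • b)_n(ḡ a) = i(b)_n(a)` for EVERY `g ∈ G`**
(II.4.6: "there exists a unique `𝒢`-homomorphism `i`"; the `hequiv` of `exists_twisting_μ_eq_forall_of_units`).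
[cite: deShalit1987, I.3.4 Lemma (ii) and Corollary (p. 18), II.4.6 (14) (p. 59)] -/
theorem induce_μ_smul_of_character (g : G) (b : B) (n : ℕ) (a : G ⧸ 𝒰.U n) :
    (GroupDistribution.induce (fun b ↦ (GroupDistribution.comap (restrictUnits ((invAmice₁ 2 ((PowerSeries.subst (compSeriesC h2 hσ₀ u hε)
          ((tildeSer ((u : 𝒪[F]) * ((2 : ℕ) : 𝒪[F])) (LTCoeff.of F (u : 𝒪[F])) (η b).logDeriv).map
            ((intToUnrCoeff F).comp (LTCoeff.of F).symm.toRingHom))).map Θ) (hC b)).density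
          (ProfiniteTower.padicInt_isUniform 2) (unitInv 𝕜) uniformContinuous_unitInv norm_unitInv_le))
          ψ (𝒰.cellMap_trans κ ψ hψ) (𝒰.cellMap_injective κ hU ψ hψ) (𝒰.cellMap_fiberSurj κ hU hκ ψ hψ))) hC0 hCb (g • b)).μ n (𝒰.proj n g * a) =
      (GroupDistribution.induce (fun b ↦ (GroupDistribution.comap (restrictUnits ((invAmice₁ 2 ((PowerSeries.subst (compSeriesC h2 hσ₀ u hε)
          ((tildeSer ((u : 𝒪[F]) * ((2 : ℕ) : 𝒪[F])) (LTCoeff.of F (u : 𝒪[F])) (η b).logDeriv).map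
            ((intToUnrCoeff F).comp (LTCoeff.of F).symm.toRingHom))).map Θ) (hC b)).density
          (ProfiniteTower.padicInt_isUniform 2) (unitInv 𝕜) uniformContinuous_unitInv norm_unitInv_le))
          ψ (𝒰.cellMap_trans κ ψ hψ) (𝒰.cellMap_injective κ hU ψ hψ) (𝒰.cellMap_fiberSurj κ hU hκ ψ hψ))) hC0 hCb b).μ n a :=
  GroupDistribution.induce_μ_smul _ hC0 hCb
    (comap_μ_proj_mul_normCoherentUnits_of_character hq h2 hσ₀ u hε Θ e hΘe κ hU hκ ψ hψ η hη hC) g b n a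

include hq hΘe hη in
/-- **`i(b)` reads `D_b` on the cells inside `U_0`.** [cite: deShalit1987, I.3.4 (p. 18), II.4.6 (13) (p. 59)] -/
theorem induce_μ_of_transLE_eq_one_of_character (b : B) (n : ℕ) (a : G ⧸ 𝒰.U n)
    (ha : 𝒰.transLE (Nat.zero_le n) a = 1) :
    (GroupDistribution.induce (fun b ↦ (GroupDistribution.comap (restrictUnits ((invAmice₁ 2 ((PowerSeries.subst (compSeriesC h2 hσ₀ u hε)
          ((tildeSer ((u : 𝒪[F]) * ((2 : ℕ) : 𝒪[F])) (LTCoeff.of F (u : 𝒪[F])) (η b).logDeriv).map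
            ((intToUnrCoeff F).comp (LTCoeff.of F).symm.toRingHom))).map Θ) (hC b)).density
          (ProfiniteTower.padicInt_isUniform 2) (unitInv 𝕜) uniformContinuous_unitInv norm_unitInv_le))
          ψ (𝒰.cellMap_trans κ ψ hψ) (𝒰.cellMap_injective κ hU ψ hψ) (𝒰.cellMap_fiberSurj κ hU hκ ψ hψ))) hC0 hCb b).μ n a =
      (GroupDistribution.comap (restrictUnits ((invAmice₁ 2 ((PowerSeries.subst (compSeriesC h2 hσ₀ u hε)
          ((tildeSer ((u : 𝒪[F]) * ((2 : ℕ) : 𝒪[F])) (LTCoeff.of F (u : 𝒪[F])) (η b).logDeriv).map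
            ((intToUnrCoeff F).comp (LTCoeff.of F).symm.toRingHom))).map Θ) (hC b)).density
          (ProfiniteTower.padicInt_isUniform 2) (unitInv 𝕜) uniformContinuous_unitInv norm_unitInv_le))
          ψ (𝒰.cellMap_trans κ ψ hψ) (𝒰.cellMap_injective κ hU ψ hψ) (𝒰.cellMap_fiberSurj κ hU hκ ψ hψ)).μ n a :=
  GroupDistribution.induce_μ_of_transLE_eq_one _ hC0 hCb
    (comap_μ_proj_mul_normCoherentUnits_of_character hq h2 hσ₀ u hε Θ e hΘe κ hU hκ ψ hψ η hη hC) b n a ha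

end NormCoherentUnitFamilyAbstract

end Literature.NumberTheory.EllipticCurves

end
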